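import Summits.QuantumFields.BalabanUV.T4Continuum.Support.VariationalVectorFederbushSum

/-!
# T⁴ programme, spine node NE2 (U1a), lane P2 — SUPPLIER LEAF V-FED, file 4: THE TWO MISMATCH BINDERS DISCHARGED FOR PRODUCT LINE TRANSPORTS
# `T(y,j,t,ν) = T′(n·y+j) ∘ Π^ν_t(n·y+j)` (a SITE transport to the block frame after the STRAIGHT transport along the line — the structure of
# [Balaban1985AveragingOperations] (125) «R(V₀; c₋, x)·R(x → x + t e_μ)», SHAPE; DATA): the non-abelian rectangle estimate
# `‖Π^μ_m(p)∘Π^ν_ℓ(p + m e_μ) − Π^ν_ℓ(p)∘Π^μ_m(p + ℓ e_ν)‖ ≤ m·ℓ·a` from the operator plaquette defect `a`, whence (M2) `w′ ≤ n²·a` and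
# (M1) `m ≤ m₀ + n²·a` with `m₀` = FED⁺'s SITE mismatch `‖misv‖` — V-FED's binders are the scalar∕colour leaf's binder plus the plaquette defect
# (`t4/skeletons/NE2-t4-ne2-p2.md` v0.15 §2.E row V-FED; cell `pub-balaban`)

NE2 formalisation swarm `b2b-balaban-t4-ne2-formalise-*`, leaf prover 01 GEN 5 (`prover-b2b-balaban-t4-ne2-formalise-leaf-01-g5-0`); file 4 of the V-FED line (files 1–2
`VariationalVectorFederbush{,Sum}` p216586 ∕ p216754: carriers `misL`, `pathL`, the lattice theorem `curlSq_QvL_le` under (M1) `‖misL‖ ≤ m`, (M2)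
`‖pathL(s,t;μ,ν) − pathL(t,s;ν,μ)‖ ≤ w′`), the colour Federbush file `VariationalColourFederbush` (`piTv`, `misv`, `norm_piTv_le_one`) BY NAME.

THE STATEMENTS (model level; `E` any normed ℂ-space; block side `n`, coarse torus `Tor M`, fine torus `Tor (fine n M)`; fine bond transports `R′(x,μ)` with
`‖R′‖ ≤ 1` and OPERATOR PLAQUETTE DEFECT `‖R′(x,κ)∘R′(x+e_κ,ι) − R′(x,ι)∘R′(x+e_ι,κ)‖ ≤ a`; site transports `T′(x)` with `‖T′‖ ≤ 1`; coarse `Rc`).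
 * §7 **`norm_mul_piTv_sub_le`** (one bond across a line: `‖R′(p,μ)∘Π^ν_ℓ(p+e_μ) − Π^ν_ℓ(p)∘R′(p+ℓe_ν,μ)‖ ≤ ℓ·a`) and **`norm_piTv_comm_sub_le`** (THE RECTANGLE:
   `‖Π^μ_m(p)∘Π^ν_ℓ(p+me_μ) − Π^ν_ℓ(p)∘Π^μ_m(p+ℓe_ν)‖ ≤ m·ℓ·a`) — non-abelian lattice Stokes in estimate form (no commutativity; insert-and-telescope,
   `‖AB − CD‖ ≤ ‖A − C‖‖B‖ + ‖C‖‖B − D‖` with contractions); the U(1) identity is leaf-04-g2's `VariationalTaxiCoarse.piT_mul_piT_shift`.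
 * §8 `lineT T′ R′ y j t ν := T′(n·y+j) ∘ Π^ν_t(n·y+j)` (product line transports), `norm_lineT_le_one`; **`norm_pathL_sub_pathL_line_le`**: (M2) with
   `w′ = n·n·a`; **`norm_misL_line_le`**: `‖misL‖ ≤ ‖misv‖ + n·n·a` — (M1) with `m = m₀ + n·n·a` where `‖misv Rc R′ T′‖ ≤ m₀` is EXACTLY the binder of
   the scalar∕colour FED⁺ (`VariationalColourFederbush.dirUv_Qcv_le`).
 * §9 **`curlSq_QvL_line_le`**: V-FED for product line transports under the ROAD'S STANDARD BINDERS (`m₀`, `a`):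
   `curlSq Rc (Q_{T′∘Π} W) ≤ ( √(n²·curlSq R′ W∕n^d) + d·(2(m₀ + n²a) + 2n·(n²a))·√(nsqV W∕n^d) )²`.
   Honest sizes (taxi∕CLASS lineage, not here): `a ≍` fine plaquette field, `m₀ ≲ C·n²·a` for taxi site transports; in physical units at coarse level `N`
   the defect is `N·n³·a = O(n∕N)` under the scale-invariant class `(N n)²·a ≤ c` — geometric along the tower.
WHAT IS NOT HERE: the sizes of `m₀` (leaf-04-g2's `VariationalTaxiCoarse` pattern, U(1)), the physical-units reading (file 3 `VariationalVectorFederbushPhys` composes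
verbatim with §9's binders), anything about `G`.

HONEST FRAMING (T4-DAG p. 1).  Model level; transports DATA; [folklore] insert-and-telescope with operator norms; nothing printed is a hypothesis; data `def`
`lineT` only, no `def … : Prop`, no `sorry`; axioms standard.  NE2 NOT proved; spine PROVED 0∕9 unchanged; rung (B)+1 finite T⁴ — NOT infinite volume, NOT
mass gap, NOT Clay.  HONEST DEPENDENCY (cell, verbatim): continuum YM on T⁴ ⇐ BetaPertH ∧ nine spine estimates (0/9 proved); BetaPertH ⇐ (D1) ∧ (D4) ∧
CAP+tail; G-an2-4 gates asym, D1 and NE2/3/4.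
-/

noncomputable section

namespace Summit.QuantumFields.BalabanUV.T4Continuum.VariationalVectorFederbush

open Finset
open Literature.MathematicalPhysics.QuantumFieldTheory.Balaban1983to89
open Literature.MathematicalPhysics.QuantumFieldTheory.Balaban1983to89.B5Prop11Plancherel (Tor fine unitVec)
open Literature.MathematicalPhysics.QuantumFieldTheory.Balaban1983to89.B5Block118 (tstep tstep_zero tstep_succ bpt bpt_add_tstep)
open Summit.QuantumFields.BalabanUV.T4Continuum.VariationalColourFederbush (piTv misv norm_piTv_le_one)
open Summit.QuantumFields.BalabanUV.T4Continuum.VectorBlockTrialForm (nsqV nsqV_nonneg QvL)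
open Summit.QuantumFields.BalabanUV.T4Continuum.VariationalVectorForm (curlV curlSq curlSq_nonneg)

variable {d : ℕ} {E : Type*} [NormedAddCommGroup E] [NormedSpace ℂ E]
variable (n : ℕ) [NeZero n] (M : Fin d → ℕ) [hM : ∀ μ, NeZero (M μ)]

/-! ## §7 The non-abelian rectangle estimate for straight transporters -/

section Rectangle

variable {R' : Tor (fine n M) → Fin d → (E →L[ℂ] E)}

omit [NeZero n] hM in
/-- `‖A∘B − C∘D‖ ≤ ‖A − C‖·‖B‖ + ‖C‖·‖B − D‖` (insert `C∘B`). [folklore] -/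
theorem norm_mul_sub_mul_le (A B C D : E →L[ℂ] E) : ‖A * B - C * D‖ ≤ ‖A - C‖ * ‖B‖ + ‖C‖ * ‖B - D‖ := by
  have e : A * B - C * D = (A - C) * B + C * (B - D) := by simp only [sub_mul, mul_sub]; abel
  rw [e]
  exact (norm_add_le _ _).trans (add_le_add (norm_mul_le _ _) (norm_mul_le _ _))

omit [NeZero n] hM in
/-- **ONE BOND ACROSS A LINE**: `‖R′(p,μ)∘Π^ν_ℓ(p+e_μ) − Π^ν_ℓ(p)∘R′(p+ℓe_ν,μ)‖ ≤ ℓ·a` — the `μ`-bond at the start of `ℓ` bonds in direction `ν` is moved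
to their end through `ℓ` plaquettes. [folklore] -/
theorem norm_mul_piTv_sub_le (hR' : ∀ x μ, ‖R' x μ‖ ≤ 1) {a : ℝ}
    (ha : ∀ x κ ι, ‖R' x κ * R' (x + unitVec (fine n M) κ) ι - R' x ι * R' (x + unitVec (fine n M) ι) κ‖ ≤ a)
    (p : Tor (fine n M)) (μ ν : Fin d) (ℓ : ℕ) :
    ‖R' p μ * piTv n M R' (p + unitVec (fine n M) μ) ν ℓ - piTv n M R' p ν ℓ * R' (p + tstep (fine n M) ν ℓ) μ‖ ≤ ℓ * a := by
  induction ℓ with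
  | zero => simp [piTv, tstep_zero]
  | succ ℓ ih =>
    have ha0 : 0 ≤ a := (norm_nonneg _).trans (ha p μ ν)
    -- `Π^ν_{ℓ+1}(q) = Π^ν_ℓ(q) ∘ R′(q + ℓ e_ν, ν)` at both base points, and the point bookkeeping
    have h1 : piTv n M R' (p + unitVec (fine n M) μ) ν (ℓ + 1)
        = piTv n M R' (p + unitVec (fine n M) μ) ν ℓ * R' (p + tstep (fine n M) ν ℓ + unitVec (fine n M) μ) ν := by
      simp only [piTv, add_right_comm]
    have h2 : piTv n M R' p ν (ℓ + 1) = piTv n M R' p ν ℓ * R' (p + tstep (fine n M) ν ℓ) ν := by simp only [piTv]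
    have h3 : p + tstep (fine n M) ν (ℓ + 1) = p + tstep (fine n M) ν ℓ + unitVec (fine n M) ν := by rw [tstep_succ, add_assoc]
    rw [h1, h2, h3]
    set q := p + tstep (fine n M) ν ℓ with hq
    -- insert `Π^ν_ℓ(p) ∘ R′(q,μ) ∘ R′(q+e_μ,ν)`
    have e : R' p μ * (piTv n M R' (p + unitVec (fine n M) μ) ν ℓ * R' (q + unitVec (fine n M) μ) ν)
          - piTv n M R' p ν ℓ * R' q ν * R' (q + unitVec (fine n M) ν) μ
        = (R' p μ * piTv n M R' (p + unitVec (fine n M) μ) ν ℓ - piTv n M R' p ν ℓ * R' q μ) * R' (q + unitVec (fine n M) μ) ν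
          + piTv n M R' p ν ℓ * (R' q μ * R' (q + unitVec (fine n M) μ) ν - R' q ν * R' (q + unitVec (fine n M) ν) μ) := by
      simp only [sub_mul, mul_sub, mul_assoc]; abel
    rw [e]
    calc _ ≤ ‖(R' p μ * piTv n M R' (p + unitVec (fine n M) μ) ν ℓ - piTv n M R' p ν ℓ * R' q μ) * R' (q + unitVec (fine n M) μ) ν‖
          + ‖piTv n M R' p ν ℓ * (R' q μ * R' (q + unitVec (fine n M) μ) ν - R' q ν * R' (q + unitVec (fine n M) ν) μ)‖ := norm_add_le _ _
      _ ≤ (ℓ * a) * 1 + 1 * a := by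
          refine add_le_add ((norm_mul_le _ _).trans (mul_le_mul ih (hR' _ _) (norm_nonneg _) (by positivity)))
            ((norm_mul_le _ _).trans (mul_le_mul (norm_piTv_le_one n M hR' _ _ _) (ha _ _ _) (norm_nonneg _) zero_le_one))
      _ = ((ℓ + 1 : ℕ) : ℝ) * a := by push_cast; ring

omit [NeZero n] hM in
/-- **THE RECTANGLE** (non-abelian lattice Stokes, estimate form): `‖Π^μ_m(p)∘Π^ν_ℓ(p + m e_μ) − Π^ν_ℓ(p)∘Π^μ_m(p + ℓ e_ν)‖ ≤ m·ℓ·a` — the two comb paths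
from `p + m e_μ + ℓ e_ν` to `p` differ by at most the number of plaquettes of the rectangle times the plaquette defect. [folklore] -/
theorem norm_piTv_comm_sub_le (hR' : ∀ x μ, ‖R' x μ‖ ≤ 1) {a : ℝ}
    (ha : ∀ x κ ι, ‖R' x κ * R' (x + unitVec (fine n M) κ) ι - R' x ι * R' (x + unitVec (fine n M) ι) κ‖ ≤ a)
    (p : Tor (fine n M)) (μ ν : Fin d) (m ℓ : ℕ) :
    ‖piTv n M R' p μ m * piTv n M R' (p + tstep (fine n M) μ m) ν ℓ - piTv n M R' p ν ℓ * piTv n M R' (p + tstep (fine n M) ν ℓ) μ m‖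
      ≤ m * ℓ * a := by
  induction m with
  | zero => simp [piTv, tstep_zero]
  | succ m ih =>
    have h1 : piTv n M R' p μ (m + 1) = piTv n M R' p μ m * R' (p + tstep (fine n M) μ m) μ := by simp only [piTv]
    have h2 : piTv n M R' (p + tstep (fine n M) ν ℓ) μ (m + 1)
        = piTv n M R' (p + tstep (fine n M) ν ℓ) μ m * R' (p + tstep (fine n M) μ m + tstep (fine n M) ν ℓ) μ := by
      simp only [piTv, add_right_comm]
    have h3 : p + tstep (fine n M) μ (m + 1) = p + tstep (fine n M) μ m + unitVec (fine n M) μ := by rw [tstep_succ, add_assoc]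
    rw [h1, h2, h3]
    set q := p + tstep (fine n M) μ m with hq
    have hone := norm_mul_piTv_sub_le n M hR' ha q μ ν ℓ
    -- insert `Π^μ_m(p) ∘ Π^ν_ℓ(q) ∘ R′(q + ℓ e_ν, μ)`
    have e : piTv n M R' p μ m * R' q μ * piTv n M R' (q + unitVec (fine n M) μ) ν ℓ
          - piTv n M R' p ν ℓ * (piTv n M R' (p + tstep (fine n M) ν ℓ) μ m * R' (q + tstep (fine n M) ν ℓ) μ)
        = piTv n M R' p μ m * (R' q μ * piTv n M R' (q + unitVec (fine n M) μ) ν ℓ - piTv n M R' q ν ℓ * R' (q + tstep (fine n M) ν ℓ) μ)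
          + (piTv n M R' p μ m * piTv n M R' q ν ℓ - piTv n M R' p ν ℓ * piTv n M R' (p + tstep (fine n M) ν ℓ) μ m)
            * R' (q + tstep (fine n M) ν ℓ) μ := by
      simp only [sub_mul, mul_sub, mul_assoc]; abel
    rw [e]
    have ha0 : 0 ≤ a := (norm_nonneg _).trans (ha p μ ν)
    calc _ ≤ ‖piTv n M R' p μ m * (R' q μ * piTv n M R' (q + unitVec (fine n M) μ) ν ℓ - piTv n M R' q ν ℓ * R' (q + tstep (fine n M) ν ℓ) μ)‖
          + ‖(piTv n M R' p μ m * piTv n M R' q ν ℓ - piTv n M R' p ν ℓ * piTv n M R' (p + tstep (fine n M) ν ℓ) μ m)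
              * R' (q + tstep (fine n M) ν ℓ) μ‖ := norm_add_le _ _
      _ ≤ 1 * (ℓ * a) + (m * ℓ * a) * 1 := by
          refine add_le_add ((norm_mul_le _ _).trans (mul_le_mul (norm_piTv_le_one n M hR' _ _ _) hone (norm_nonneg _) zero_le_one))
            ((norm_mul_le _ _).trans (mul_le_mul ih (hR' _ _) (norm_nonneg _) (by positivity)))
      _ = ((m + 1 : ℕ) : ℝ) * ℓ * a := by push_cast; ring

end Rectangle

/-! ## §8 Product line transports: the two binders of V-FED discharged -/

section LineTransports

/-- **PRODUCT LINE TRANSPORTS** `T(y,j,t,ν) := T′(n·y + j) ∘ Π^ν_t(n·y + j)`: the bond variable at position `t` of the `ν`-line started at `x = n·y + j` is carried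
back to `x` ALONG THE LINE and then to the block frame by the site transport `T′(x)` ([Balaban1985AveragingOperations] (125) SHAPE «R(V₀; c₋, x)·(…)»; DATA).
[folklore] -/
def lineT (T' : Tor (fine n M) → (E →L[ℂ] E)) (R' : Tor (fine n M) → Fin d → (E →L[ℂ] E))
    (y : Tor M) (j : Fin d → Fin n) (t : Fin n) (ν : Fin d) : E →L[ℂ] E :=
  T' (bpt n M y j) * piTv n M R' (bpt n M y j) ν t

variable {Rc : Tor M → Fin d → (E →L[ℂ] E)} {R' : Tor (fine n M) → Fin d → (E →L[ℂ] E)} {T' : Tor (fine n M) → (E →L[ℂ] E)}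

omit [NeZero n] hM in
/-- contractive data give contractive line transports. [folklore] -/
theorem norm_lineT_le_one (hR' : ∀ x μ, ‖R' x μ‖ ≤ 1) (hT' : ∀ x, ‖T' x‖ ≤ 1) (y : Tor M) (j : Fin d → Fin n) (t : Fin n) (ν : Fin d) :
    ‖lineT n M T' R' y j t ν‖ ≤ 1 := by
  unfold lineT
  calc _ ≤ ‖T' (bpt n M y j)‖ * ‖piTv n M R' (bpt n M y j) ν t‖ := norm_mul_le _ _
    _ ≤ 1 * 1 := mul_le_mul (hT' _) (norm_piTv_le_one n M hR' _ _ _) (norm_nonneg _) zero_le_one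
    _ = 1 := one_mul 1

omit [NeZero n] hM in
/-- **(M2) DISCHARGED**: for product line transports the two comb transports differ by the site transport applied to the rectangle commutator:
`‖pathL(s,t;μ,ν) − pathL(t,s;ν,μ)‖ ≤ s·t·a ≤ n·n·a`. [folklore] -/
theorem norm_pathL_sub_pathL_line_le (hR' : ∀ x μ, ‖R' x μ‖ ≤ 1) (hT' : ∀ x, ‖T' x‖ ≤ 1) {a : ℝ}
    (ha : ∀ x κ ι, ‖R' x κ * R' (x + unitVec (fine n M) κ) ι - R' x ι * R' (x + unitVec (fine n M) ι) κ‖ ≤ a)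
    (y : Tor M) (j : Fin d → Fin n) (s t : Fin n) (μ ν : Fin d) :
    ‖pathL n M R' (lineT n M T' R') y j s t μ ν - pathL n M R' (lineT n M T' R') y j t s ν μ‖ ≤ (n : ℝ) * n * a := by
  have ha0 : 0 ≤ a := (norm_nonneg _).trans (ha (bpt n M y j) μ ν)
  have hrect := norm_piTv_comm_sub_le n M hR' ha (bpt n M y j) ν μ t s
  unfold pathL lineT
  rw [mul_assoc, mul_assoc, ← mul_sub]
  calc _ ≤ ‖T' (bpt n M y j)‖ * ‖piTv n M R' (bpt n M y j) ν t * piTv n M R' (bpt n M y j + tstep (fine n M) ν t) μ s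
          - piTv n M R' (bpt n M y j) μ s * piTv n M R' (bpt n M y j + tstep (fine n M) μ s) ν t‖ := norm_mul_le _ _
    _ ≤ 1 * (t * s * a) := mul_le_mul (hT' _) hrect (norm_nonneg _) zero_le_one
    _ ≤ (n : ℝ) * n * a := by
        rw [one_mul]
        have ht : ((t : ℕ) : ℝ) ≤ n := by exact_mod_cast t.is_lt.le
        have hs : ((s : ℕ) : ℝ) ≤ n := by exact_mod_cast s.is_lt.le
        gcongr

omit [NeZero n] hM in
/-- **(M1) DISCHARGED**: for product line transports the across-block line mismatch is FED⁺'s SITE mismatch carried along the line, plus the rectangle between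
the two orders of «`n` bonds in direction `μ`» and «`t` bonds in direction `ν`»: `‖misL‖ ≤ ‖misv Rc R′ T′(y,μ,j)‖ + n·n·a`. [folklore] -/
theorem norm_misL_line_le (hR' : ∀ x μ, ‖R' x μ‖ ≤ 1) (hT' : ∀ x, ‖T' x‖ ≤ 1) {a : ℝ}
    (ha : ∀ x κ ι, ‖R' x κ * R' (x + unitVec (fine n M) κ) ι - R' x ι * R' (x + unitVec (fine n M) ι) κ‖ ≤ a)
    (y : Tor M) (j : Fin d → Fin n) (t : Fin n) (μ ν : Fin d) :
    ‖misL n M Rc R' (lineT n M T' R') y j t μ ν‖ ≤ ‖misv n M Rc R' T' y μ j‖ + (n : ℝ) * n * a := by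
  have ha0 : 0 ≤ a := (norm_nonneg _).trans (ha (bpt n M y j) μ ν)
  have hb : bpt n M (y + unitVec M μ) j = bpt n M y j + tstep (fine n M) μ n := (bpt_add_tstep n M y j μ).symm
  have hrect := norm_piTv_comm_sub_le n M hR' ha (bpt n M y j) μ ν n t
  -- `misL = misv ∘ Π^ν_t(b′) + T′(b) ∘ (rectangle commutator)`
  have e : misL n M Rc R' (lineT n M T' R') y j t μ ν
      = misv n M Rc R' T' y μ j * piTv n M R' (bpt n M y j + tstep (fine n M) μ n) ν t
        + T' (bpt n M y j) * (piTv n M R' (bpt n M y j) μ n * piTv n M R' (bpt n M y j + tstep (fine n M) μ n) ν t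
            - piTv n M R' (bpt n M y j) ν t * piTv n M R' (bpt n M y j + tstep (fine n M) ν t) μ n) := by
    simp only [misL, lineT, misv, hb, sub_mul, mul_sub, mul_assoc]
    abel
  rw [e]
  calc _ ≤ ‖misv n M Rc R' T' y μ j * piTv n M R' (bpt n M y j + tstep (fine n M) μ n) ν t‖
        + ‖T' (bpt n M y j) * (piTv n M R' (bpt n M y j) μ n * piTv n M R' (bpt n M y j + tstep (fine n M) μ n) ν t
            - piTv n M R' (bpt n M y j) ν t * piTv n M R' (bpt n M y j + tstep (fine n M) ν t) μ n)‖ := norm_add_le _ _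
    _ ≤ ‖misv n M Rc R' T' y μ j‖ * 1 + 1 * (n * t * a) :=
        add_le_add ((norm_mul_le _ _).trans (mul_le_mul_of_nonneg_left (norm_piTv_le_one n M hR' _ _ _) (norm_nonneg _)))
          ((norm_mul_le _ _).trans (mul_le_mul (hT' _) hrect (norm_nonneg _) zero_le_one))
    _ ≤ ‖misv n M Rc R' T' y μ j‖ + (n : ℝ) * n * a := by
        rw [mul_one, one_mul]
        have ht : ((t : ℕ) : ℝ) ≤ n := by exact_mod_cast t.is_lt.le
        gcongr

/-! ## §9 V-FED for product line transports under the road's standard binders -/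

/-- **LEAF V-FED FOR PRODUCT LINE TRANSPORTS (lattice units)**: contractive `R′`, `T′`; FED⁺'s site mismatch `‖misv Rc R′ T′‖ ≤ m₀`; operator plaquette defect
`≤ a`.  THEN `curlSq Rc (Q_{T′∘Π} W) ≤ ( √(n²·curlSq R′ W∕n^d) + d·(2(m₀ + n²a) + 2n·(n²a))·√(nsqV W∕n^d) )²` — main term constant EXACTLY 1, the
background through the two standard binders only. [folklore] -/
theorem curlSq_QvL_line_le (hR' : ∀ x μ, ‖R' x μ‖ ≤ 1) (hT' : ∀ x, ‖T' x‖ ≤ 1) {m₀ a : ℝ} (hm₀ : 0 ≤ m₀) (ha0 : 0 ≤ a)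
    (hmis : ∀ y μ j, ‖misv n M Rc R' T' y μ j‖ ≤ m₀)
    (ha : ∀ x κ ι, ‖R' x κ * R' (x + unitVec (fine n M) κ) ι - R' x ι * R' (x + unitVec (fine n M) ι) κ‖ ≤ a)
    (W : Tor (fine n M) → Fin d → E) :
    curlSq M Rc (QvL n M (lineT n M T' R') W)
      ≤ (Real.sqrt ((n : ℝ) ^ 2 * curlSq (fine n M) R' W / (n : ℝ) ^ d)
          + d * ((2 * (m₀ + n * n * a) + 2 * n * (n * n * a)) * Real.sqrt (nsqV (fine n M) W / (n : ℝ) ^ d))) ^ 2 :=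
  curlSq_QvL_le n M hR' (norm_lineT_le_one n M hR' hT') (by positivity) (by positivity)
    (fun y j t μ ν => (norm_misL_line_le n M hR' hT' ha y j t μ ν).trans (add_le_add (hmis y μ j) le_rfl))
    (fun y j s t μ ν => norm_pathL_sub_pathL_line_le n M hR' hT' ha y j s t μ ν) W

end LineTransports

end Summit.QuantumFields.BalabanUV.T4Continuum.VariationalVectorFederbush

end
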